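import Mathlib
import Summits.BirchSwinnertonDyer.BirchSwinnertonDyer.Theorems.ResidualThetaTransportAtTwoSignedMuSeedAtTwoPlusNonsquareDescentGrowthContraction
import HarnessLib

/-!
# Non-square descent — IWASAWA GROWTH AT `μ = 0`, PART II: `ω_{n+1}M = p·ω_nM` FOR `n ≫ 0` (Nakayama) AND THE EVENTUALLY GEOMETRIC COUNT
# `#(M/ω_{n+1}M) = c·#(M/ω_nM)` — the module-level «`μ = 0 ⟹` linear growth of the exponent» of stub S2 of the line card
# `nonsquare-descent`, seed crux `SignedMuSeedAtTwoPlus` stmt-BirchSwinnertonDyer-21438 (parent Kμ⁺ `SignedMuVanishingAtTwoPlus`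
# stmt-BirchSwinnertonDyer-20689, route ResidualThetaTransportAtTwo)

Cell `bsd-wall`, width seat `bsd-wall-rtt-p4-w2` g18 (`--supports`, closes nothing).  THEOREMS ONLY; BSD is not proved by this and
nothing arithmetic is asserted: commutative algebra over an arbitrary commutative ring.

Continuation of `Theorems/…NonsquareDescentGrowthContraction.lean` (`ω_n • S ≤ p^j • S` for `N j ≤ n + 1` when `T^N • S ≤ p • S`).  Setting: `R` a
commutative ring, `p : ℕ` with `(p) ⊆ Jac(R)` (e.g. `R = Λ'` local), `T ∈ R`, `M` a finitely generated `R`-module with `T^N M ⊆ pM`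
(«`μ = 0`»: for a f.g. torsion `Λ`-module this says `M/pM` has finite length) and BOUNDED `p`-POWER TORSION (`p^i x = 0 ⟹ p^k x = 0`, automatic
for f.g. modules over Noetherian `Λ`), `ω_n = (1+T)^{pⁿ} − 1`, `N_n = ω_n M`.

* §1 `smul_left_injective_of_le` — `p` acts injectively on every submodule `S ⊆ p^k M`.
* §2 **`span_nu_smul_eq`** — NAKAYAMA STEP: if `ν = p + ω q`, `N` f.g. and `ω N ⊆ p² N` then `ν N = p N`.
* §3 **`span_omega_succ_smul_eq`** — for `2 N₀ ≤ n + 1`: `ω_{n+1} M = p · ω_n M` («`ν_n` acts on `ω_n M` as `p × unit`» — Washington §13.3's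
  mechanism, here for ALL `p` including `2`, with no structure theorem).
* §4 `exists_linearEquiv_smul` — for `n` deep enough `y ↦ p y` is an `R`-linear ISOMORPHISM `ω_n M ≃ ω_{n+1} M`.
* §5 **`natCard_quotient_eq_mul`**, **`natCard_quotient_succ_eq`**, **`natCard_quotient_omega_eq_mul_pow`** — `#(M/A) = #(B/A)·#(M/B)` bookkeeping,
  `#(M/ω_{n+1}M) = #(M/ω_nM) · c_n` with `c_n = #(ω_nM / p ω_nM)` CONSTANT in `n ≥ n₂`, hence `#(M/ω_nM) = #(M/ω_{n₂}M) · c^{n−n₂}`: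
  LINEAR GROWTH of the exponent («`μ(Q') = 0 ⟹ ord #(Q'/ω_nQ') = λ' n + ν`», the growth lemma of stub S2, module form; `c` is a power of
  `p` when `p` is prime and the count is finite, since `ω_nM/pω_nM` is killed by `p`).

[folklore]
-/

set_option autoImplicit false
-- the Theorems namespace of this sub repeats the summit name by design (D-0017 nested layout)
set_option linter.dupNamespace false

open Finset
open scoped Pointwise

namespace Summit.BirchSwinnertonDyer.BirchSwinnertonDyer.Theorems.SignedMuAtTwo.NonsquareDescent

variable {R : Type*} [CommRing R] {M : Type*} [AddCommGroup M] [Module R M]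

/-! ## §1 `p` is injective deep inside `M` -/

/-- Bounded `p`-power torsion (`p^i x = 0 ⟹ p^k x = 0`) makes `p` injective on every submodule `S ⊆ p^k M`. [folklore] -/
theorem smul_left_injective_of_le (p : ℕ) (k : ℕ)
    (htor : ∀ (x : M) (i : ℕ), ((p : R) ^ i) • x = 0 → ((p : R) ^ k) • x = 0)
    {S : Submodule R M} (hS : S ≤ Ideal.span {(p : R) ^ k} • (⊤ : Submodule R M))
    {x : M} (hx : x ∈ S) (h0 : (p : R) • x = 0) : x = 0 := by
  have h1 := hS hx
  rw [Submodule.ideal_span_singleton_smul, Submodule.mem_smul_pointwise_iff_exists] at h1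
  obtain ⟨y, -, rfl⟩ := h1
  have h2 : ((p : R) ^ (k + 1)) • y = 0 := by rw [pow_succ', mul_smul, h0]
  exact htor y (k + 1) h2

/-! ## §2 The Nakayama step `ν N = p N` -/

/-- **Nakayama step.**  `(p) ⊆ Jac(R)`, `ν = p + ω q`, `N` a finitely generated submodule with `ω N ⊆ p² N`: then `ν N = p N`.
(`⊆`: `ν y = p y + q ω y ∈ pN`; `⊇`: `pN ⊆ νN + p·(pN)` and Nakayama.) [folklore] -/
theorem span_nu_smul_eq (p : ℕ) (hjac : Ideal.span {(p : R)} ≤ (⊥ : Ideal R).jacobson)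
    {ω ν q : R} (hν : ν = (p : R) + ω * q)
    (N : Submodule R M) (hN : N.FG) (hω : Ideal.span {ω} • N ≤ (Ideal.span {(p : R)}) ^ 2 • N) :
    Ideal.span {ν} • N = Ideal.span {(p : R)} • N := by
  have hω' : ∀ y ∈ N, ω • y ∈ Ideal.span {(p : R)} • (Ideal.span {(p : R)} • N) := fun y hy => by
    rw [← Submodule.mul_smul, ← pow_two]
    exact hω (Submodule.smul_mem_smul (Ideal.mem_span_singleton_self ω) hy)
  have hpp : Ideal.span {(p : R)} • (Ideal.span {(p : R)} • N) ≤ Ideal.span {(p : R)} • N :=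
    Submodule.smul_mono le_rfl Submodule.smul_le_right
  apply le_antisymm
  · rw [Submodule.smul_le]
    intro r hr y hy
    obtain ⟨a, rfl⟩ := Ideal.mem_span_singleton'.mp hr
    rw [mul_smul]
    refine Submodule.smul_mem _ a ?_
    rw [hν, add_smul, mul_smul, smul_comm ω q y]
    exact Submodule.add_mem _ (Submodule.smul_mem_smul (Ideal.mem_span_singleton_self _) hy)
      (Submodule.smul_mem _ q (hpp (hω' y hy)))
  · have hfg : (Ideal.span {(p : R)} • N).FG := Submodule.FG.smul ⟨{(p : R)}, by simp⟩ hN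
    refine Submodule.le_of_le_smul_of_le_jacobson_bot hfg hjac ?_
    rw [Submodule.smul_le]
    intro r hr y hy
    obtain ⟨a, rfl⟩ := Ideal.mem_span_singleton'.mp hr
    rw [mul_smul]
    refine Submodule.smul_mem _ a ?_
    have hpy : (p : R) • y = ν • y - q • (ω • y) := by rw [hν, add_smul, mul_smul, smul_comm q ω y, add_sub_cancel_right]
    rw [hpy]
    exact Submodule.sub_mem _ (Submodule.mem_sup_left (Submodule.smul_mem_smul (Ideal.mem_span_singleton_self _) hy))
      (Submodule.mem_sup_right (Submodule.smul_mem _ q (hω' y hy)))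

/-! ## §3 `ω_{n+1} M = p · ω_n M` for `n ≫ 0` -/

/-- `ν_n = p + ω_n q` for some `q` (`ω_n ∣ ν_n − p`, `…TowerNorms`). [folklore] -/
theorem exists_nu_eq_add_mul (p : ℕ) (T : R) (n : ℕ) :
    ∃ q : R, (∑ i ∈ range p, (1 + T) ^ (p ^ n * i)) = (p : R) + ((1 + T) ^ (p ^ n) - 1) * q := by
  obtain ⟨q, hq⟩ := sub_one_dvd_geom_sum_sub_natCast (1 + T) (p ^ n) p
  exact ⟨q, by rw [← hq]; ring⟩

/-- **`ω_{n+1} • M = p • (ω_n • M)` for `2 N₀ ≤ n + 1`**, given `T^{N₀} M ⊆ pM`, `(p) ⊆ Jac(R)` and `M` finitely generated: the level-`n+1` submodule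
is EXACTLY `p` times the level-`n` one («`ν_n = ω_{n+1}/ω_n` acts on `ω_n M` as `p × (unit)`», valid for every `p`, `p = 2` included). [folklore] -/
theorem span_omega_succ_smul_eq [Module.Finite R M] (p : ℕ) (T : R)
    (hjac : Ideal.span {(p : R)} ≤ (⊥ : Ideal R).jacobson) (N₀ : ℕ)
    (hT : Ideal.span {T ^ N₀} • (⊤ : Submodule R M) ≤ Ideal.span {(p : R)} • ⊤) {n : ℕ} (hn : N₀ * 2 ≤ n + 1) :
    Ideal.span {(1 + T) ^ (p ^ (n + 1)) - 1} • (⊤ : Submodule R M) =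
      Ideal.span {(p : R)} • (Ideal.span {(1 + T) ^ (p ^ n) - 1} • (⊤ : Submodule R M)) := by
  obtain ⟨q, hq⟩ := exists_nu_eq_add_mul p T n
  have hfac : (1 + T) ^ (p ^ (n + 1)) - 1 =
      (∑ i ∈ range p, (1 + T) ^ (p ^ n * i)) * ((1 + T) ^ (p ^ n) - 1) := by
    rw [pow_succ]
    exact pow_mul_sub_one_eq_geom_sum_mul (1 + T) (p ^ n) p
  rw [hfac, ← Ideal.span_singleton_mul_span_singleton, Submodule.mul_smul]
  refine span_nu_smul_eq p hjac hq _
    (Submodule.FG.smul ⟨{(1 + T) ^ (p ^ n) - 1}, by simp⟩ Module.Finite.fg_top) ?_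
  exact omega_smul_le_pow_smul p T _ N₀ (T_pow_smul_le_of_smul p T ⊤ N₀ hT _) hn

/-! ## §4 `y ↦ p y : ω_n M ≃ ω_{n+1} M` -/

/-- For `n` deep enough (`2 N₀ ≤ n + 1` and `N₀ k ≤ n + 1`), multiplication by `p` is an `R`-linear ISOMORPHISM `ω_n M ≃ ω_{n+1} M`
(onto by §3, injective by §1). [folklore] -/
theorem exists_linearEquiv_smul [Module.Finite R M] (p : ℕ) (T : R)
    (hjac : Ideal.span {(p : R)} ≤ (⊥ : Ideal R).jacobson) (N₀ : ℕ)
    (hT : Ideal.span {T ^ N₀} • (⊤ : Submodule R M) ≤ Ideal.span {(p : R)} • ⊤)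
    (k : ℕ) (htor : ∀ (x : M) (i : ℕ), ((p : R) ^ i) • x = 0 → ((p : R) ^ k) • x = 0)
    {n : ℕ} (hn : N₀ * 2 ≤ n + 1) (hnk : N₀ * k ≤ n + 1) :
    ∃ e : ↥(Ideal.span {(1 + T) ^ (p ^ n) - 1} • (⊤ : Submodule R M)) ≃ₗ[R]
        ↥(Ideal.span {(1 + T) ^ (p ^ (n + 1)) - 1} • (⊤ : Submodule R M)),
      ∀ y, ((e y : M)) = (p : R) • (y : M) := by
  have hsucc := span_omega_succ_smul_eq p T hjac N₀ hT hn
  have hdeep : Ideal.span {(1 + T) ^ (p ^ n) - 1} • (⊤ : Submodule R M) ≤ Ideal.span {(p : R) ^ k} • ⊤ :=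
    omega_smul_le_span_pow_smul p T ⊤ N₀ hT hnk
  have hmem : ∀ y ∈ Ideal.span {(1 + T) ^ (p ^ n) - 1} • (⊤ : Submodule R M),
      (LinearMap.lsmul R M (p : R)) y ∈ Ideal.span {(1 + T) ^ (p ^ (n + 1)) - 1} • (⊤ : Submodule R M) := by
    intro y hy
    rw [hsucc, LinearMap.lsmul_apply]
    exact Submodule.smul_mem_smul (Ideal.mem_span_singleton_self _) hy
  let f := (LinearMap.lsmul R M (p : R)).restrict hmem
  have hf : ∀ y, ((f y : M)) = (p : R) • (y : M) := fun y => rfl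
  refine ⟨LinearEquiv.ofBijective f ⟨fun y y' h => ?_, fun z => ?_⟩, fun y => hf y⟩
  · have h1 : (p : R) • ((y : M) - y') = 0 := by
      rw [smul_sub, ← hf, ← hf, h, sub_self]
    exact Subtype.ext (sub_eq_zero.mp
      (smul_left_injective_of_le p k htor hdeep (Submodule.sub_mem _ y.2 y'.2) h1))
  · have hz : (z : M) ∈ Ideal.span {(p : R)} • (Ideal.span {(1 + T) ^ (p ^ n) - 1} • (⊤ : Submodule R M)) := by
      rw [← hsucc]; exact z.2
    rw [Submodule.ideal_span_singleton_smul, Submodule.mem_smul_pointwise_iff_exists] at hz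
    obtain ⟨y, hy, hyz⟩ := hz
    exact ⟨⟨y, hy⟩, Subtype.ext (by rw [hf]; exact hyz)⟩

/-! ## §5 Counting: `#(M/ω_{n+1}M) = #(M/ω_nM) · c` with `c` constant -/

/-- `#(M/A) = #(B / (A ∩ B)) · #(M/B)` for submodules `A ≤ B` (third isomorphism theorem bookkeeping). [folklore] -/
theorem natCard_quotient_eq_mul (A B : Submodule R M) (h : A ≤ B) :
    Nat.card (M ⧸ A) = Nat.card (↥B ⧸ A.comap B.subtype) * Nat.card (M ⧸ B) := by
  rw [Submodule.card_eq_card_quotient_mul_card (B.map A.mkQ),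
    Nat.card_congr (Submodule.quotientQuotientEquivQuotient A B h).toEquiv]
  congr 1
  have hker : LinearMap.ker (A.mkQ.comp B.subtype) = A.comap B.subtype := by
    rw [LinearMap.ker_comp, Submodule.ker_mkQ]
  have hrange : LinearMap.range (A.mkQ.comp B.subtype) = B.map A.mkQ := by
    rw [LinearMap.range_comp, Submodule.range_subtype]
  rw [← Nat.card_congr ((LinearMap.quotKerEquivRange (A.mkQ.comp B.subtype)).trans
    (LinearEquiv.ofEq _ _ hrange)).toEquiv, hker]

/-- `(I • B) ∩ B`, seen inside `B`, is `I • ⊤`. [folklore] -/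
theorem comap_subtype_smul (I : Ideal R) (B : Submodule R M) :
    (I • B).comap B.subtype = I • (⊤ : Submodule R ↥B) := by
  have h1 : (I • (⊤ : Submodule R ↥B)).map B.subtype = I • B := by
    rw [Submodule.map_smul'', Submodule.map_subtype_top]
  rw [← h1, Submodule.comap_map_eq_of_injective B.injective_subtype]

/-- **`#(M/ω_{n+1}M) = c_n · #(M/ω_nM)` with `c_n = #(ω_nM / p·ω_nM)`**, for `2 N₀ ≤ n + 1`. [folklore] -/
theorem natCard_quotient_succ_eq [Module.Finite R M] (p : ℕ) (T : R)
    (hjac : Ideal.span {(p : R)} ≤ (⊥ : Ideal R).jacobson) (N₀ : ℕ)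
    (hT : Ideal.span {T ^ N₀} • (⊤ : Submodule R M) ≤ Ideal.span {(p : R)} • ⊤) {n : ℕ} (hn : N₀ * 2 ≤ n + 1) :
    Nat.card (M ⧸ Ideal.span {(1 + T) ^ (p ^ (n + 1)) - 1} • (⊤ : Submodule R M)) =
      Nat.card (↥(Ideal.span {(1 + T) ^ (p ^ n) - 1} • (⊤ : Submodule R M)) ⧸
          (Ideal.span {(p : R)} • (⊤ : Submodule R ↥(Ideal.span {(1 + T) ^ (p ^ n) - 1} • (⊤ : Submodule R M))))) *
        Nat.card (M ⧸ Ideal.span {(1 + T) ^ (p ^ n) - 1} • (⊤ : Submodule R M)) := by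
  have hsucc := span_omega_succ_smul_eq p T hjac N₀ hT hn
  rw [hsucc, natCard_quotient_eq_mul _ _ Submodule.smul_le_right, comap_subtype_smul]

/-- **The factor `c_n = #(ω_nM / p·ω_nM)` is CONSTANT for `n` deep enough** (transport along `y ↦ p y : ω_nM ≃ ω_{n+1}M`). [folklore] -/
theorem natCard_layerQuotient_succ_eq [Module.Finite R M] (p : ℕ) (T : R)
    (hjac : Ideal.span {(p : R)} ≤ (⊥ : Ideal R).jacobson) (N₀ : ℕ)
    (hT : Ideal.span {T ^ N₀} • (⊤ : Submodule R M) ≤ Ideal.span {(p : R)} • ⊤)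
    (k : ℕ) (htor : ∀ (x : M) (i : ℕ), ((p : R) ^ i) • x = 0 → ((p : R) ^ k) • x = 0)
    {n : ℕ} (hn : N₀ * 2 ≤ n + 1) (hnk : N₀ * k ≤ n + 1) :
    Nat.card (↥(Ideal.span {(1 + T) ^ (p ^ (n + 1)) - 1} • (⊤ : Submodule R M)) ⧸
          (Ideal.span {(p : R)} • (⊤ : Submodule R ↥(Ideal.span {(1 + T) ^ (p ^ (n + 1)) - 1} • (⊤ : Submodule R M))))) =
      Nat.card (↥(Ideal.span {(1 + T) ^ (p ^ n) - 1} • (⊤ : Submodule R M)) ⧸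
          (Ideal.span {(p : R)} • (⊤ : Submodule R ↥(Ideal.span {(1 + T) ^ (p ^ n) - 1} • (⊤ : Submodule R M))))) := by
  obtain ⟨e, -⟩ := exists_linearEquiv_smul p T hjac N₀ hT k htor hn hnk
  have hmap : (Ideal.span {(p : R)} • (⊤ : Submodule R ↥(Ideal.span {(1 + T) ^ (p ^ n) - 1} • (⊤ : Submodule R M)))).map
      e.toLinearMap = Ideal.span {(p : R)} • ⊤ := by
    rw [Submodule.map_smul'', Submodule.map_top, LinearEquiv.range]
  exact (Nat.card_congr (Submodule.Quotient.equiv _ _ e hmap).toEquiv).symm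

/-- **LINEAR GROWTH AT `μ = 0` (module form).**  `R` commutative, `(p) ⊆ Jac(R)`, `M` finitely generated with `T^{N₀} M ⊆ pM` («`μ = 0`») and bounded
`p`-power torsion.  Then there are `n₂` and `c` with `#(M/ω_nM) = #(M/ω_{n₂}M) · c^{n − n₂}` for all `n ≥ n₂` (`ω_n = (1+T)^{pⁿ} − 1`; `Nat.card`,
so the identity is also meaningful — trivially — when the quotients are infinite): the exponent of `#(M/ω_nM)` grows LINEARLY, with slope
`log c` («`μ(Q') = 0 ⟹ ord₂ #(Q'/ω_nQ') = λ'·n + ν` for `n ≫ 0`», the growth lemma of stub S2). [folklore] -/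
theorem natCard_quotient_omega_eq_mul_pow [Module.Finite R M] (p : ℕ) (T : R)
    (hjac : Ideal.span {(p : R)} ≤ (⊥ : Ideal R).jacobson) (N₀ : ℕ)
    (hT : Ideal.span {T ^ N₀} • (⊤ : Submodule R M) ≤ Ideal.span {(p : R)} • ⊤)
    (k : ℕ) (htor : ∀ (x : M) (i : ℕ), ((p : R) ^ i) • x = 0 → ((p : R) ^ k) • x = 0) :
    ∃ (n₂ c : ℕ), ∀ n : ℕ, n₂ ≤ n →
      Nat.card (M ⧸ Ideal.span {(1 + T) ^ (p ^ n) - 1} • (⊤ : Submodule R M)) =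
        Nat.card (M ⧸ Ideal.span {(1 + T) ^ (p ^ n₂) - 1} • (⊤ : Submodule R M)) * c ^ (n - n₂) := by
  refine ⟨N₀ * 2 + N₀ * k,
    Nat.card (↥(Ideal.span {(1 + T) ^ (p ^ (N₀ * 2 + N₀ * k)) - 1} • (⊤ : Submodule R M)) ⧸
      (Ideal.span {(p : R)} • (⊤ : Submodule R ↥(Ideal.span {(1 + T) ^ (p ^ (N₀ * 2 + N₀ * k)) - 1} • (⊤ : Submodule R M))))),
    fun n hn => ?_⟩
  -- the layer quotient count is constant from `n₂` on
  have hconst : ∀ m : ℕ, N₀ * 2 + N₀ * k ≤ m →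
      Nat.card (↥(Ideal.span {(1 + T) ^ (p ^ m) - 1} • (⊤ : Submodule R M)) ⧸
          (Ideal.span {(p : R)} • (⊤ : Submodule R ↥(Ideal.span {(1 + T) ^ (p ^ m) - 1} • (⊤ : Submodule R M))))) =
        Nat.card (↥(Ideal.span {(1 + T) ^ (p ^ (N₀ * 2 + N₀ * k)) - 1} • (⊤ : Submodule R M)) ⧸
          (Ideal.span {(p : R)} • (⊤ : Submodule R ↥(Ideal.span {(1 + T) ^ (p ^ (N₀ * 2 + N₀ * k)) - 1} •
            (⊤ : Submodule R M))))) := by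
    intro m hm
    induction m, hm using Nat.le_induction with
    | base => rfl
    | succ m hm ih =>
      rw [← ih]
      exact natCard_layerQuotient_succ_eq p T hjac N₀ hT k htor (by omega) (by omega)
  induction n, hn using Nat.le_induction with
  | base => rw [Nat.sub_self, pow_zero, mul_one]
  | succ n hn ih =>
    rw [natCard_quotient_succ_eq p T hjac N₀ hT (by omega), ih, hconst n hn, Nat.succ_sub hn, pow_succ]
    ring

end Summit.BirchSwinnertonDyer.BirchSwinnertonDyer.Theorems.SignedMuAtTwo.NonsquareDescent
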